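import Summits.KontsevichZagierPeriods.KontsevichZagierPeriods.Theses.MarkovTreeOfMoves
import Literature.NumberTheory.Transcendental.AyoubRelative

/-!
# `PeriodSequenceMove` (stmt-KontsevichZagierPeriods-4541, route MarkovTreeOfMoves, rank 3) — line `ayoubgerm`

TRANSFER LINE (crux-strategist, 2026-08-17): the solved sibling of this crux is Ayoub's RELATIVE
Kontsevich–Zagier theorem in its corrected, purely algebraic form — J. Ayoub, *La version relative de
la conjecture des périodes de Kontsevich–Zagier revisitée*, Tohoku Math. J. 71 (2019), Théorème 1.7,
vendored in the tree as the NAMED FACT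
`Literature.NumberTheory.Transcendental.AyoubRel.ayoub_relativeKZ_revisited` (file
`Literature/NumberTheory/Transcendental/AyoubRelative.lean`; its Example 1.16 is literally the torus
period series `1/(1 − ϖ (t₁+t₁⁻¹)(t₂+t₂⁻¹))` of a Laurent polynomial). The crux hypothesis
`∀ k, CT(fᵏ) = CT(gᵏ)` says EXACTLY that the algebraic Laurent series
`F = Σₖ (fᵏ − gᵏ) ϖᵏ = 1/(1−ϖf) − 1/(1−ϖg) ∈ 𝒪†_alg(𝔼ⁿ)` has term-by-term integral
`∫ F = Σₖ (CT fᵏ − CT gᵏ) ϖᵏ = 0`; Théorème 1.7 then writes `F` as a finite `ℚ`-combination of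
Ayoub's generators (a) `∂G/∂zᵢ − G|_{zᵢ=1} + G|_{zᵢ=0}` and (b) `tⱼ ∂H/∂tⱼ` with ALGEBRAIC Laurent
series `G, H` in the torus variables of `f, g`, auxiliary cube variables `z` AND auxiliary torus
variables `t_{n+1}, …, t_{n+m}` (the proof computes `F†(k)` as a colimit over `(𝔼¹,1)^{∧N}`, note
Thm. 2.14, so auxiliary torus variables are intrinsic). Four named pieces:

* `stub_ayoubRelativeKZ` — the named fact itself (a published THEOREM; its Lean discharge = Ayoub's
  motivic proof, not expected: closing the crux through this line is CONDITIONAL on it, trust base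
  = that one name).
* `stub_germSpecialisation` (TRUE given the fact; heavy but elementary analysis, size XL): inside the
  common disc of convergence of the finitely many certificate series `G, H` on the compact cycle
  `[0,1]^M × Tⁿ⁺ᵐ` (Eisenstein-type bounds: the `ϖᵐ`-coefficients of an algebraic element of
  `ℚ[z,t^±]((ϖ))` have degree `O(m)` and height `C^m`, so there is a uniform radius `δ > 0`), the
  identity specialises at every rational `|t| < δ` to a pointwise identity of `ℚ`-semialgebraic
  real-analytic functions in the tan-half-angle chart, and each generator integrates to a KZ relation:
  (a) = Newton–Leibniz along a cube variable + re-inflation (the calibration pattern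
  `AyoubRelACubeCalibration` of route AyoubSpecialisation), (b) = `J·Re(tⱼ∂ⱼH) = J^{(j)} ∂_{uⱼ}(Im H)`,
  killed by the route's one-directional block (split at `|uⱼ| = 1`, chart `v = 1/uⱼ`, two rule-3
  moves). Integrating out the cube variables leaves the STABILISED torus-period representations
  `[ℝᵐ × ℝⁿ, ∏_{i<m} 2/(1+uᵢ²) · J(u')·Re(1/(1 − t f(x(u'))))]` (`f` read in `m` more variables):
  conclusion = `∃ m δ, ∀ |t| < δ`, these are KZ-equivalent for `f` and `g`.
* `stub_destabilisation` — `[2π]^{⋆m}`-cancellation for torus-period shapes at an honest parameter: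
  equivalence of the stabilised pair ⇒ equivalence of `R_f(t), R_g(t)`. Transcendence-free; the
  torus-shape instance of the open crux `AyoubPiCancellation` (route AyoubSpecialisation, item
  stmt-KontsevichZagierPeriods-0540: `[π] ⋆ c ∈ relations → c ∈ relations`); the integer analogue
  `TorsionFree` (route CoactionDevissage, stmt-3169) is PROVED in the tree.
* `stub_honestTransport` — from relations at all small honest rational `t` to every honest rational
  `t₀` (continuation in the parameter at the level of moves). This is where the transfer BREAKS:
  beyond the certificate radius the continued `G, H` are multivalued on the torus (the singular values
  `ϖ*(p)` braid around `t₀` as `p` loops in `Tⁿ`) and may acquire poles ON the cycle, so no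
  specialisation argument reaches `t₀`; the same wall is recorded for cube families as the
  why-might-fail of `TateFamilyKernel` (route InverseLandau) and is the content of birth's
  `stub_flatSlabTransport` minus its "why equivalent at all" half, which this line discharges by the
  named fact. Hypothesis deliberately the WEAKEST that glues (actual relations near `0`, not only an
  identically vanishing period function), so a prover may use the germ certificates if a mechanism
  is found; `MutationIsAMove` (stmt-4540, `∃ δ`) feeds the same stub on mutation-complete classes.

Composition (sorry-free): `PeriodSequenceMove_of_stubs : S1 → S2 → S3 → S4 → (crux unfolded)` and
`PeriodSequenceMove_of : PeriodSequenceMove` from the four stubs BY NAME. Disproof used: none on file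
(`ledger crux ls` shows only Lines/birth.*; `ledger negatives --problem KontsevichZagierPeriods` has no
Laurent/torus statement). Honesty is used by S3 (existence of the stabilised representations) and S4.
-/

set_option linter.dupNamespace false

namespace Summit.KontsevichZagierPeriods.KontsevichZagierPeriods.Cruxes.PeriodSequenceMove.AyoubGerm

open scoped BigOperators
open Summit.KontsevichZagierPeriods.KontsevichZagierPeriods.Theses.MarkovTreeOfMoves (PeriodSequenceMove)

/-- **Stub S1 — `ayoubRelativeKZ` (NAMED FACT = Ayoub, relative KZ revisited, Théorème 1.7).**
For a field `k` of characteristic `0` embeddable in `ℂ`, an algebraic Laurent series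
`F ∈ 𝒪†_alg(𝔸^∞ × 𝔼^∞)` has term-by-term integral `0` iff it lies in the `k`-span of the generators
(a) `∂G/∂zᵢ − G|_{zᵢ=1} + G|_{zᵢ=0}`, (b) `tⱼ∂H/∂tⱼ` (`G, H ∈ 𝒪†_alg`). A published theorem whose
proof is motivic (Voevodsky motives over `k(ϖ)`, rigid-analytic motives, Betti realisation); it
stays a named fact in `Literature/NumberTheory/Transcendental/AyoubRelative.lean` (the easy
direction `⇐` is proved there). Listed as a stub so that the composition is kernel-checked; closing
the crux through this line is conditional on exactly this name. [AyoubRelKZRevisited, Théorème 1.7;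
Ayoub2015, Thm. 4.25 with the erratum Rem. 1.3] -/
theorem stub_ayoubRelativeKZ :
    Literature.NumberTheory.Transcendental.AyoubRel.ayoub_relativeKZ_revisited := by
  sorry

/-- **Stub S2 — `germSpecialisation` (Ayoub certificates specialise inside their disc of
convergence; TRUE given S1, size XL).** Assuming Théorème 1.7: for Laurent polynomials `f, g` over
`ℚ` in `n` variables with equal period sequences there are `m : ℕ` (number of auxiliary torus
variables of the certificate) and `δ > 0` (the common radius of convergence of the certificate series
on the cycle, below the honesty radius) such that for every rational `|t| < δ` the STABILISED
torus-period representations `[ℝ^{m+n}, ∏_{i<m} 2/(1+uᵢ²) · J(u')·Re(1/(1 − t f(x(u'))))]` and the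
same for `g` (`u' = (u_m, …, u_{m+n-1})`) are KZ-equivalent. Plan: `F = Σ(fᵏ−gᵏ)ϖᵏ ∈ Odagger ℚ`
(annihilated by `(1−ϖf)(1−ϖg)Y − ϖ(f−g)`, the `toLaurent_mem_Odagger` pattern of
`LandauTateFamilyOdagger.lean`), `intLaurent ℚ F = 0` from the hypothesis (`monoWeight (0,b) = [b = 0]`),
S1 ⇒ `F ∈ span(ayoubGenerators ℚ)`; Eisenstein bounds ⇒ uniform convergence of all `G, H` and their
derivatives on `[0,1]^M × T^{m+n}` for `|ϖ| ≤ δ`; specialise, take real parts in the chart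
(`ℚ`-semialgebraic by a CAD root-selection argument, continuous branches), integrate: type (a) ↦
Newton–Leibniz in `zᵢ` + re-inflation, type (b) ↦ one-directional block in `uⱼ`, cube variables
integrated out by rule 3 with primitive `zᵢ·(…)`, finite sums by rule 1b.
[AyoubRelKZRevisited Thm 1.7, Notation 1.6, Ex. 1.16; KontsevichZagier2001 §1.2] -/
theorem stub_germSpecialisation :
    Literature.NumberTheory.Transcendental.AyoubRel.ayoub_relativeKZ_revisited →
    ∀ (n : ℕ) (ev : AddMonoidAlgebra ℚ (Fin n → ℤ) → (Fin n → ℂ) → ℂ) (tc : (Fin n → ℝ) → (Fin n → ℂ)) (J : (Fin n → ℝ) → ℝ), (∀ f x, ev f x = f.coeff.sum (fun v c => (c : ℂ) * ∏ i, x i ^ (v i))) → (∀ u i, tc u i = (((1 - u i ^ 2 : ℝ) : ℂ) + ((2 * u i : ℝ) : ℂ) * Complex.I) / ((1 + u i ^ 2 : ℝ) : ℂ)) → (∀ u, J u = ∏ i, 2 / (1 + u i ^ 2)) → ∀ (f g : AddMonoidAlgebra ℚ (Fin n → ℤ)), (∀ k : ℕ, (f ^ k).coeff 0 = (g ^ k).coeff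 0) → ∃ (m : ℕ) (δ : ℝ), 0 < δ ∧ ∀ t : ℚ, |(t : ℝ)| < δ → ∀ (R R' : Literature.NumberTheory.Transcendental.KZ.IntegralRep (m + n)), R.domain = Set.univ → (∀ u, R.integrand u = (∏ i : Fin m, 2 / (1 + u (Fin.castAdd n i) ^ 2)) * (J (fun i => u (Fin.natAdd m i)) * (1 / (1 - (t : ℂ) * ev f (tc (fun i => u (Fin.natAdd m i))))).re)) → R'.domain = Set.univ → (∀ u, R'.integrand u = (∏ i : Fin m, 2 / (1 + u (Fin.castAdd n i) ^ 2)) * (J (fun i => u (Fin.natAdd m i)) * (1 / (1 - (t : ℂ) * ev g (tc (fun i => u (Fin.natAdd m i))))).re)) → Literature.NumberTheory.Transcendental.KZ.Equivalent R R' := by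
  sorry

/-- **Stub S3 — `destabilisation` (`[2π]^{⋆m}`-cancellation for torus-period shapes; open,
transcendence-free).** At an HONEST rational parameter `t` (so that all representations below exist),
if the stabilised torus-period representations of `f` and `g` with `m` auxiliary Haar factors
`2/(1+uᵢ²)` are KZ-equivalent, then so are `R_f(t)` and `R_g(t)` themselves. Values: `(2π)^m·v`
versus `v`, so this is the statement that `[2π] = [ℝ, 2/(1+u²)]` is a non-zero-divisor on
`FormalRep ⧸ relations` restricted to these shapes — the torus instance of `AyoubPiCancellation`
(route AyoubSpecialisation, open) after `[2π] ~ 2•[π]` and `TorsionFree` (route CoactionDevissage,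
PROVED: `n • c ∈ relations → c ∈ relations`). Why it might fail: a certificate for the stabilised
pair may mix the auxiliary coordinates with the others by changes of variables, leaving no slice
certificate; no value of any period is constrained by it. [AyoubRelKZRevisited Notation 1.9 (iii);
HuberWustholz2022 App. A.4; KontsevichZagier2001 §1.2] -/
theorem stub_destabilisation :
    ∀ (n : ℕ) (ev : AddMonoidAlgebra ℚ (Fin n → ℤ) → (Fin n → ℂ) → ℂ) (tc : (Fin n → ℝ) → (Fin n → ℂ)) (J : (Fin n → ℝ) → ℝ), (∀ f x, ev f x = f.coeff.sum (fun v c => (c : ℂ) * ∏ i, x i ^ (v i))) → (∀ u i, tc u i = (((1 - u i ^ 2 : ℝ) : ℂ) + ((2 * u i : ℝ) : ℂ) * Complex.I) / ((1 + u i ^ 2 : ℝ) : ℂ)) → (∀ u, J u = ∏ i, 2 / (1 + u i ^ 2)) → ∀ (m : ℕ) (f g : AddMonoidAlgebra ℚ (Fin n → ℤ)) (t : ℚ), (∀ x : Fin n → ℂ, (∀ i, ‖x i‖ = 1) → ‖(t : ℂ) * ev f x‖ < 1 ∧ ‖(t : ℂ) * ev g x‖ < 1) → (∀ (R R' : Literature.NumberTheory.Transcendental.KZ.IntegralRep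 (m + n)), R.domain = Set.univ → (∀ u, R.integrand u = (∏ i : Fin m, 2 / (1 + u (Fin.castAdd n i) ^ 2)) * (J (fun i => u (Fin.natAdd m i)) * (1 / (1 - (t : ℂ) * ev f (tc (fun i => u (Fin.natAdd m i))))).re)) → R'.domain = Set.univ → (∀ u, R'.integrand u = (∏ i : Fin m, 2 / (1 + u (Fin.castAdd n i) ^ 2)) * (J (fun i => u (Fin.natAdd m i)) * (1 / (1 - (t : ℂ) * ev g (tc (fun i => u (Fin.natAdd m i))))).re)) → Literature.NumberTheory.Transcendental.KZ.Equivalent R R') → ∀ (r r' : Literature.NumberTheory.Transcendental.KZ.IntegralRep n), r.domain = Set.univ → (∀ u, r.integrand u = J u * (1 / (1 - (t : ℂ) * ev f (tc u))).re) → r'.domain = Set.univ → (∀ u, r'.integrand u = J u * (1 / (1 - (t : ℂ) * ev g (tc u))).re) → Literature.NumberTheory.Transcendental.KZ.Equivalent r r' := by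
  sorry

/-- **Stub S4 — `honestTransport` (continuation in the parameter at the level of moves; the
hardest stub).** If `R_f(t) ~ R_g(t)` for every HONEST rational `t` in some neighbourhood
`|t| < δ` of the trivial fibre, then `R_f(t₀) ~ R_g(t₀)` for every honest rational `t₀`
(`|t₀ f|, |t₀ g| < 1` on the unit torus). No period-sequence hypothesis: by soundness the germ
relations already force `π_f ≡ π_g`. This is the half of the crux that NO engine reaches (Ayoub
certificates and mutation homotopies both stop at a radius); it is weaker than birth's
`stub_flatSlabTransport` (whose hypothesis is only value-level) and is fed by S2+S3 here and by
`MutationIsAMove` (stmt-4540, `∃ δ`) on mutation-complete classes. Why it might fail: it is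
Conjecture 1 for the slab difference `[ℝⁿ×[t,t₀], ∂_τ(F_f − F_g)]` at one small rational `t`; the
continued Ayoub primitives are multivalued with poles on the cycle, and the Picard–Fuchs transport
needs transcendental integrating factors for `ord L ≥ 2` (MUM point at `0`).
[KontsevichZagier2001 §1.2; Lairez2015; BostanLairezSalvy2013; AyoubRelKZRevisited] -/
theorem stub_honestTransport :
    ∀ (n : ℕ) (ev : AddMonoidAlgebra ℚ (Fin n → ℤ) → (Fin n → ℂ) → ℂ) (tc : (Fin n → ℝ) → (Fin n → ℂ)) (J : (Fin n → ℝ) → ℝ), (∀ f x, ev f x = f.coeff.sum (fun v c => (c : ℂ) * ∏ i, x i ^ (v i))) → (∀ u i, tc u i = (((1 - u i ^ 2 : ℝ) : ℂ) + ((2 * u i : ℝ) : ℂ) * Complex.I) / ((1 + u i ^ 2 : ℝ) : ℂ)) → (∀ u, J u = ∏ i, 2 / (1 + u i ^ 2)) → ∀ (f g : AddMonoidAlgebra ℚ (Fin n → ℤ)), (∃ δ : ℝ, 0 < δ ∧ ∀ t : ℚ, |(t : ℝ)| < δ → (∀ x : Fin n → ℂ, (∀ i, ‖x i‖ = 1)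 → ‖(t : ℂ) * ev f x‖ < 1 ∧ ‖(t : ℂ) * ev g x‖ < 1) → ∀ (r r' : Literature.NumberTheory.Transcendental.KZ.IntegralRep n), r.domain = Set.univ → (∀ u, r.integrand u = J u * (1 / (1 - (t : ℂ) * ev f (tc u))).re) → r'.domain = Set.univ → (∀ u, r'.integrand u = J u * (1 / (1 - (t : ℂ) * ev g (tc u))).re) → Literature.NumberTheory.Transcendental.KZ.Equivalent r r') → ∀ t₀ : ℚ, (∀ x : Fin n → ℂ, (∀ i, ‖x i‖ = 1) → ‖(t₀ : ℂ) * ev f x‖ < 1 ∧ ‖(t₀ : ℂ) * ev g x‖ < 1) → ∀ (r r' : Literature.NumberTheory.Transcendental.KZ.IntegralRep n), r.domain = Set.univ → (∀ u, r.integrand u = J u * (1 / (1 - (t₀ : ℂ) * ev f (tc u))).re) → r'.domain = Set.univ → (∀ u, r'.integrand u = J u * (1 / (1 - (t₀ : ℂ) * ev g (tc u))).re) → Literature.NumberTheory.Transcendental.KZ.Equivalent r r' := by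
  sorry

/-! ## The composition (sorry-free) -/

/-- Abbreviation-free statement of the stabilised germ conclusion used by S2 and S3 (documentation
only; the stubs spell it out). The composition: S2 (fed S1) gives `m, δ`; for a small honest `t`, S3
destabilises the germ equivalence to `R_f(t) ~ R_g(t)`; S4 transports to every honest `t₀`.
Conclusion = `PeriodSequenceMove` unfolded verbatim. [KontsevichZagier2001 §1.2] -/
theorem PeriodSequenceMove_of_stubs
    (h1 : Literature.NumberTheory.Transcendental.AyoubRel.ayoub_relativeKZ_revisited)
    (h2 : Literature.NumberTheory.Transcendental.AyoubRel.ayoub_relativeKZ_revisited →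
    ∀ (n : ℕ) (ev : AddMonoidAlgebra ℚ (Fin n → ℤ) → (Fin n → ℂ) → ℂ) (tc : (Fin n → ℝ) → (Fin n → ℂ)) (J : (Fin n → ℝ) → ℝ), (∀ f x, ev f x = f.coeff.sum (fun v c => (c : ℂ) * ∏ i, x i ^ (v i))) → (∀ u i, tc u i = (((1 - u i ^ 2 : ℝ) : ℂ) + ((2 * u i : ℝ) : ℂ) * Complex.I) / ((1 + u i ^ 2 : ℝ) : ℂ)) → (∀ u, J u = ∏ i, 2 / (1 + u i ^ 2)) → ∀ (f g : AddMonoidAlgebra ℚ (Fin n → ℤ)), (∀ k : ℕ, (f ^ k).coeff 0 = (g ^ k).coeff 0) → ∃ (m : ℕ) (δ : ℝ), 0 < δ ∧ ∀ t : ℚ, |(t : ℝ)| < δ → ∀ (R R' : Literature.NumberTheory.Transcendental.KZ.IntegralRep (m + n)), R.domain = Set.univ → (∀ u, R.integrand u = (∏ i : Fin m, 2 / (1 + u (Fin.castAdd n i) ^ 2)) * (J (fun i => u (Fin.natAdd m i)) * (1 / (1 - (t : ℂ) * ev f (tc (fun i => u (Fin.natAdd m i))))).re)) → R'.domain = Set.univ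 → (∀ u, R'.integrand u = (∏ i : Fin m, 2 / (1 + u (Fin.castAdd n i) ^ 2)) * (J (fun i => u (Fin.natAdd m i)) * (1 / (1 - (t : ℂ) * ev g (tc (fun i => u (Fin.natAdd m i))))).re)) → Literature.NumberTheory.Transcendental.KZ.Equivalent R R')
    (h3 : ∀ (n : ℕ) (ev : AddMonoidAlgebra ℚ (Fin n → ℤ) → (Fin n → ℂ) → ℂ) (tc : (Fin n → ℝ) → (Fin n → ℂ)) (J : (Fin n → ℝ) → ℝ), (∀ f x, ev f x = f.coeff.sum (fun v c => (c : ℂ) * ∏ i, x i ^ (v i))) → (∀ u i, tc u i = (((1 - u i ^ 2 : ℝ) : ℂ) + ((2 * u i : ℝ) : ℂ) * Complex.I) / ((1 + u i ^ 2 : ℝ) : ℂ)) → (∀ u, J u = ∏ i, 2 / (1 + u i ^ 2)) → ∀ (m : ℕ) (f g : AddMonoidAlgebra ℚ (Fin n → ℤ)) (t : ℚ), (∀ x : Fin n → ℂ, (∀ i, ‖x i‖ = 1) → ‖(t : ℂ) * ev f x‖ < 1 ∧ ‖(t : ℂ) * ev g x‖ < 1) → (∀ (R R' : Literature.NumberTheory.Transcendental.KZ.IntegralRep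 (m + n)), R.domain = Set.univ → (∀ u, R.integrand u = (∏ i : Fin m, 2 / (1 + u (Fin.castAdd n i) ^ 2)) * (J (fun i => u (Fin.natAdd m i)) * (1 / (1 - (t : ℂ) * ev f (tc (fun i => u (Fin.natAdd m i))))).re)) → R'.domain = Set.univ → (∀ u, R'.integrand u = (∏ i : Fin m, 2 / (1 + u (Fin.castAdd n i) ^ 2)) * (J (fun i => u (Fin.natAdd m i)) * (1 / (1 - (t : ℂ) * ev g (tc (fun i => u (Fin.natAdd m i))))).re)) → Literature.NumberTheory.Transcendental.KZ.Equivalent R R') → ∀ (r r' : Literature.NumberTheory.Transcendental.KZ.IntegralRep n), r.domain = Set.univ → (∀ u, r.integrand u = J u * (1 / (1 - (t : ℂ) * ev f (tc u))).re) → r'.domain = Set.univ → (∀ u, r'.integrand u = J u * (1 / (1 - (t : ℂ) * ev g (tc u))).re) → Literature.NumberTheory.Transcendental.KZ.Equivalent r r')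
    (h4 : ∀ (n : ℕ) (ev : AddMonoidAlgebra ℚ (Fin n → ℤ) → (Fin n → ℂ) → ℂ) (tc : (Fin n → ℝ) → (Fin n → ℂ)) (J : (Fin n → ℝ) → ℝ), (∀ f x, ev f x = f.coeff.sum (fun v c => (c : ℂ) * ∏ i, x i ^ (v i))) → (∀ u i, tc u i = (((1 - u i ^ 2 : ℝ) : ℂ) + ((2 * u i : ℝ) : ℂ) * Complex.I) / ((1 + u i ^ 2 : ℝ) : ℂ)) → (∀ u, J u = ∏ i, 2 / (1 + u i ^ 2)) → ∀ (f g : AddMonoidAlgebra ℚ (Fin n → ℤ)), (∃ δ : ℝ, 0 < δ ∧ ∀ t : ℚ, |(t : ℝ)| < δ → (∀ x : Fin n → ℂ, (∀ i, ‖x i‖ = 1) → ‖(t : ℂ) * ev f x‖ < 1 ∧ ‖(t : ℂ) * ev g x‖ < 1) → ∀ (r r' : Literature.NumberTheory.Transcendental.KZ.IntegralRep n), r.domain = Set.univ → (∀ u, r.integrand u = J u * (1 / (1 - (t : ℂ) * ev f (tc u))).re) → r'.domain = Set.univ → (∀ u, r'.integrand u = J u * (1 / (1 - (t : ℂ) *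 ev g (tc u))).re) → Literature.NumberTheory.Transcendental.KZ.Equivalent r r') → ∀ t₀ : ℚ, (∀ x : Fin n → ℂ, (∀ i, ‖x i‖ = 1) → ‖(t₀ : ℂ) * ev f x‖ < 1 ∧ ‖(t₀ : ℂ) * ev g x‖ < 1) → ∀ (r r' : Literature.NumberTheory.Transcendental.KZ.IntegralRep n), r.domain = Set.univ → (∀ u, r.integrand u = J u * (1 / (1 - (t₀ : ℂ) * ev f (tc u))).re) → r'.domain = Set.univ → (∀ u, r'.integrand u = J u * (1 / (1 - (t₀ : ℂ) * ev g (tc u))).re) → Literature.NumberTheory.Transcendental.KZ.Equivalent r r') :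
    ∀ (n : ℕ) (ev : AddMonoidAlgebra ℚ (Fin n → ℤ) → (Fin n → ℂ) → ℂ) (tc : (Fin n → ℝ) → (Fin n → ℂ)) (J : (Fin n → ℝ) → ℝ), (∀ f x, ev f x = f.coeff.sum (fun v c => (c : ℂ) * ∏ i, x i ^ (v i))) → (∀ u i, tc u i = (((1 - u i ^ 2 : ℝ) : ℂ) + ((2 * u i : ℝ) : ℂ) * Complex.I) / ((1 + u i ^ 2 : ℝ) : ℂ)) → (∀ u, J u = ∏ i, 2 / (1 + u i ^ 2)) → ∀ (f g : AddMonoidAlgebra ℚ (Fin n → ℤ)), (∀ k : ℕ, (f ^ k).coeff 0 = (g ^ k).coeff 0) → ∀ t₀ : ℚ, (∀ x : Fin n → ℂ, (∀ i, ‖x i‖ = 1) → ‖(t₀ : ℂ) * ev f x‖ < 1 ∧ ‖(t₀ : ℂ) * ev g x‖ < 1) → ∀ (r r' : Literature.NumberTheory.Transcendental.KZ.IntegralRep n), r.domain = Set.univ → (∀ u, r.integrand u = J u * (1 / (1 - (t₀ : ℂ) * ev f (tc u))).re) → r'.domain = Set.univ → (∀ u, r'.integrand u = J u * (1 / (1 -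 (t₀ : ℂ) * ev g (tc u))).re) → Literature.NumberTheory.Transcendental.KZ.Equivalent r r' := by
  intro n ev tc J hev htc hJ f g hk t₀ ht r r' hr hri hr' hr'i
  obtain ⟨m, δ, hδ, hgerm⟩ := h2 h1 n ev tc J hev htc hJ f g hk
  refine h4 n ev tc J hev htc hJ f g ⟨δ, hδ, ?_⟩ t₀ ht r r' hr hri hr' hr'i
  intro t htδ htt ρ ρ' hρ hρi hρ' hρ'i
  exact h3 n ev tc J hev htc hJ m f g t htt
    (fun R R' hR hRi hR' hR'i => hgerm t htδ R R' hR hRi hR' hR'i) ρ ρ' hρ hρi hρ' hρ'i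

/-- **Skeleton theorem** (concludes the crux BY NAME): `PeriodSequenceMove` from the four declared
stubs — Ayoub's named fact, germ specialisation, destabilisation, honest transport. -/
theorem PeriodSequenceMove_of : PeriodSequenceMove :=
  PeriodSequenceMove_of_stubs stub_ayoubRelativeKZ stub_germSpecialisation stub_destabilisation
    stub_honestTransport

end Summit.KontsevichZagierPeriods.KontsevichZagierPeriods.Cruxes.PeriodSequenceMove.AyoubGerm
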